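import Literature.AlgebraicGeometry.Limits.SubalgebraSpread
import Literature.AlgebraicGeometry.Limits.FiniteTypeModelDescent
import Literature.AlgebraicGeometry.Motives.BaseChange
import HarnessLib

/-!
# A family of finite type over `ℂ` is defined over a finitely generated subring of `ℂ`

Topic `Literature/AlgebraicGeometry/Limits` (EGA IV₃ Thm. 8.8.2 (ii); Stacks Project, Tag 01ZM). The
arithmetic ("absolute") variant of the tree's `Limits.exists_countable_subfield_descent`: for
`ℂ`-schemes `𝒳`, `S` with `S` separated of finite type and a separated morphism of finite type
`f : 𝒳 ⟶ S`, there are an integral domain `R` OF FINITE TYPE OVER `ℤ` with an injective ring map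
`σ : R → ℂ`, `R`-schemes `𝒳₀`, `S₀` of finite type with a separated `R`-morphism of finite type
`f₀ : 𝒳₀ ⟶ S₀`, and isomorphisms of `ℂ`-schemes `𝒳₀ ⊗_σ ℂ ≅ 𝒳`, `S₀ ⊗_σ ℂ ≅ S` intertwining
`f₀ ⊗_σ ℂ` and `f` (`exists_finiteType_int_family_descent`). This is the first step of every
reduction-modulo-`p` argument for complex families (Serre; Maulik–Poonen 2012, §4: "spread out over
a finitely generated `ℤ`-algebra").

Proof, assembling the tree: `S` has a separated finite-type model `S₁ → Spec R₁` over a ring `R₁`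
of finite type over `ℤ` inside `ℂ` (`Limits.exists_isPullback_specMap_of_isNoetherianRing`); the
morphism `𝒳 → S ≅ S₁ ×_{R₁} Spec ℂ` is the base change of a separated finite-type
`G : X' → S₁ ×_{R₁} Spec R` for a finite-type `R₁`-algebra `R` mapping injectively to `ℂ`
(`Limits.exists_isPullback_whisker_of_hom_tensorObj`); the cartesian squares are then repackaged on
the tree's carriers `baseChangeHom σ`, exactly as in the countable-subfield file.

## References

* [EGAIV3] A. Grothendieck, J. Dieudonné, EGA IV₃, Thm. 8.8.2 (ii).
* [MaulikPoonen2012] D. Maulik, B. Poonen, Néron–Severi groups under specialization, Duke Math.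
  J. 161 (2012), §4.
-/

noncomputable section

universe u

open CategoryTheory CategoryTheory.Limits AlgebraicGeometry MonoidalCategory

namespace Literature.AlgebraicGeometry.Limits

open Literature.AlgebraicGeometry.Motives

set_option backward.isDefEq.respectTransparency false

/-- Over a locally Noetherian base, locally of finite type implies locally of finite presentation.
[folklore] -/
private theorem locallyOfFinitePresentation_of_isNoetherianRing' {A : Type*} [CommRing A]
    [IsNoetherianRing A] {Y : Scheme} (g : Y ⟶ Spec (.of A)) [LocallyOfFiniteType g] :
    LocallyOfFinitePresentation g := by
  rw [HasRingHomProperty.iff_appLE (P := @LocallyOfFinitePresentation)]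
  intro U V e
  haveI := IsLocallyNoetherian.component_noetherian (X := Spec (.of A)) U
  exact RingHom.FinitePresentation.of_finiteType.mp
    (HasRingHomProperty.appLE @LocallyOfFiniteType g inferInstance U V e)

/-- **A family of finite type over `ℂ` is defined over a finitely generated subring of `ℂ`**
(EGA IV₃ 8.8.2 (ii) over `Spec ℂ = lim Spec R`, `R ⊆ ℂ` of finite type over `ℤ`; Maulik–Poonen 2012
§4). For `ℂ`-schemes `𝒳`, `S` with `S` separated of finite type over `ℂ` and a separated morphism of
finite type `f : 𝒳 ⟶ S`, there are an integral domain `R` of finite type over `ℤ`, an injective ring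
homomorphism `σ : R →+* ℂ`, `R`-schemes `𝒳₀`, `S₀` with `S₀` separated of finite type over `R`, a
separated `R`-morphism of finite type `f₀ : 𝒳₀ ⟶ S₀`, and isomorphisms of `ℂ`-schemes
`e𝒳 : 𝒳₀ ⊗_σ ℂ ≅ 𝒳`, `eS : S₀ ⊗_σ ℂ ≅ S` intertwining `f₀ ⊗_σ ℂ` and `f`.
[cite: EGAIV3, Thm. 8.8.2 (ii)] [cite: MaulikPoonen2012, §4] -/
theorem exists_finiteType_int_family_descent {𝒳 S : SchemeOver ℂ} (f : 𝒳 ⟶ S)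
    [IsSeparated S.hom] [LocallyOfFiniteType S.hom] [QuasiCompact S.hom]
    [IsSeparated f.left] [LocallyOfFiniteType f.left] [QuasiCompact f.left] :
    ∃ (R : Type) (_ : CommRing R) (_ : IsDomain R) (_ : Algebra.FiniteType ℤ R) (σ : R →+* ℂ)
      (_ : Function.Injective σ) (𝒳₀ S₀ : SchemeOver R) (f₀ : 𝒳₀ ⟶ S₀)
      (e𝒳 : (baseChangeHom σ).obj 𝒳₀ ≅ 𝒳) (eS : (baseChangeHom σ).obj S₀ ≅ S),
      IsSeparated S₀.hom ∧ LocallyOfFiniteType S₀.hom ∧ QuasiCompact S₀.hom ∧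
      IsSeparated f₀.left ∧ LocallyOfFiniteType f₀.left ∧ QuasiCompact f₀.left ∧
      (baseChangeHom σ).map f₀ ≫ eS.hom = e𝒳.hom ≫ f := by
  classical
  -- (1) the base `S` comes from a ring `R₁ ⊆ ℂ` of finite type over `ℤ`
  obtain ⟨R₁, _, ψ₁, S₁, p₁, πS, hR₁ft, hR₁noeth, hψ₁, hsep, hlft, hqc, hsqS⟩ :=
    exists_isPullback_specMap_of_isNoetherianRing S.hom
  haveI := hsep
  haveI := hlft
  haveI := hqc
  haveI := hR₁noeth
  letI : Algebra R₁ ℂ := ψ₁.toAlgebra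
  -- the `R₁`-scheme `P = (S₁ → Spec R₁)`
  let P : SchemeOver R₁ := Over.mk p₁
  haveI : QuasiCompact P.hom := hqc
  haveI : IsSeparated P.hom := hsep
  haveI : LocallyOfFiniteType P.hom := hlft
  haveI : LocallyOfFinitePresentation P.hom := locallyOfFinitePresentation_of_isNoetherianRing' p₁
  -- the projections of `S₁ ×_{R₁} Spec ℂ`
  let fstℂ : (P ⊗ specOver R₁ ℂ).left ⟶ P.left := pullback.fst P.hom (specOver R₁ ℂ).hom
  let qℂ : (P ⊗ specOver R₁ ℂ).left ⟶ Spec (.of ℂ) := pullback.snd P.hom (specOver R₁ ℂ).hom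
  have tℂ : IsPullback fstℂ qℂ P.hom (specOver R₁ ℂ).hom := IsPullback.of_hasPullback _ _
  -- `S ≅ S₁ ×_{R₁} Spec ℂ`
  have hsqS' : IsPullback πS S.hom P.hom (specOver R₁ ℂ).hom := hsqS
  let eS₁ : S.left ≅ (P ⊗ specOver R₁ ℂ).left := hsqS'.isoPullback
  have heS₁_snd : eS₁.hom ≫ qℂ = S.hom := hsqS'.isoPullback_hom_snd
  -- (2) the morphism `𝒳 → S₁ ×_{R₁} Spec ℂ` comes from a stage `R`
  let a : 𝒳.left ⟶ (P ⊗ specOver R₁ ℂ).left := f.left ≫ eS₁.hom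
  haveI : IsSeparated a := inferInstance
  haveI : LocallyOfFiniteType a := inferInstance
  haveI : QuasiCompact a := inferInstance
  obtain ⟨R, _, _, ψ, X', G, π, ℓ, hψinj, hRft, hGsep, hGlft, hGqc, hℓ₁, hℓ₂, hsq𝒳⟩ :=
    exists_isPullback_whisker_of_hom_tensorObj P a
  haveI := hRft
  haveI := hGsep
  haveI := hGlft
  haveI := hGqc
  -- the projections of `S₁ ×_{R₁} Spec R`
  let fstR : (P ⊗ specOver R₁ R).left ⟶ P.left := pullback.fst P.hom (specOver R₁ R).hom
  let qR : (P ⊗ specOver R₁ R).left ⟶ Spec (.of R) := pullback.snd P.hom (specOver R₁ R).hom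
  have tR : IsPullback fstR qR P.hom (specOver R₁ R).hom := IsPullback.of_hasPullback _ _
  have hℓ₁' : ℓ ≫ fstR = fstℂ := hℓ₁
  have hℓ₂' : ℓ ≫ qR = qℂ ≫ Spec.map (CommRingCat.ofHom ψ.toRingHom) := hℓ₂
  -- (3) the ring `R ⊆ ℂ`
  let σ : R →+* ℂ := ψ.toRingHom
  have hσ : Function.Injective σ := hψinj
  haveI : IsDomain R := hσ.isDomain σ
  have hRZ : Algebra.FiniteType ℤ R := by
    have h := Algebra.FiniteType.trans (R := ℤ) (S := R₁) (A := R) hR₁ft hRft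
    convert h
  -- `ℓ : S₁ × Spec ℂ → S₁ × Spec R` is the base change of `Spec σ`
  have hψalg : Spec.map (CommRingCat.ofHom σ) ≫ (specOver R₁ R).hom = (specOver R₁ ℂ).hom := by
    change Spec.map (CommRingCat.ofHom ψ.toRingHom) ≫
      Spec.map (CommRingCat.ofHom (algebraMap R₁ R)) = Spec.map (CommRingCat.ofHom (algebraMap R₁ ℂ))
    rw [← Spec.map_comp, ← CommRingCat.ofHom_comp, ψ.toRingHom_eq_coe, ψ.comp_algebraMap]
  have hℓcart : IsPullback ℓ qℂ qR (Spec.map (CommRingCat.ofHom σ)) := by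
    have B : IsPullback (ℓ ≫ fstR) qℂ P.hom
        (Spec.map (CommRingCat.ofHom σ) ≫ (specOver R₁ R).hom) := by
      rw [hℓ₁', hψalg]
      exact tℂ
    exact B.of_right hℓ₂' tR
  -- (4) the `R`-schemes `S₀ = S₁ ×_{R₁} Spec R`, `𝒳₀ = X'` and `f₀ = G`
  let S₀ : SchemeOver R := Over.mk qR
  let 𝒳₀ : SchemeOver R := Over.mk (G ≫ qR)
  let f₀ : 𝒳₀ ⟶ S₀ := Over.homMk G rfl
  -- (4a) the cartesian square of `S` over `Spec σ`
  have hS : IsPullback (eS₁.hom ≫ ℓ) S.hom S₀.hom (Spec.map (CommRingCat.ofHom σ)) := by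
    have he : IsPullback eS₁.hom (eS₁.hom ≫ qℂ) qℂ (𝟙 _) :=
      IsPullback.of_horiz_isIso ⟨by rw [Category.comp_id]⟩
    have h := he.paste_horiz hℓcart
    rw [Category.id_comp, heS₁_snd] at h
    exact h
  -- (4b) the cartesian square of `𝒳` over `Spec σ`
  have ha : a ≫ qℂ = 𝒳.hom := by
    change (f.left ≫ eS₁.hom) ≫ qℂ = 𝒳.hom
    rw [Category.assoc, heS₁_snd, Over.w f]
  have h𝒳 : IsPullback π 𝒳.hom 𝒳₀.hom (Spec.map (CommRingCat.ofHom σ)) := by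
    have h := hsq𝒳.paste_vert hℓcart
    rw [ha] at h
    exact h
  -- the isomorphisms of `ℂ`-schemes
  let eS : (baseChangeHom σ).obj S₀ ≅ S :=
    Over.isoMk hS.isoPullback.symm hS.isoPullback_inv_snd
  let e𝒳 : (baseChangeHom σ).obj 𝒳₀ ≅ 𝒳 :=
    Over.isoMk h𝒳.isoPullback.symm h𝒳.isoPullback_inv_snd
  -- finiteness properties of the models
  have hS₀sep : IsSeparated S₀.hom := inferInstanceAs (IsSeparated qR)
  have hS₀lft : LocallyOfFiniteType S₀.hom := inferInstanceAs (LocallyOfFiniteType qR)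
  have hS₀qc : QuasiCompact S₀.hom := inferInstanceAs (QuasiCompact qR)
  refine ⟨R, inferInstance, inferInstance, hRZ, σ, hσ, 𝒳₀, S₀, f₀, e𝒳, eS, hS₀sep, hS₀lft, hS₀qc,
    hGsep, hGlft, hGqc, ?_⟩
  -- compatibility with `f`: computed on the two projections of `S₀ ×_R Spec ℂ`
  let bcl : pullback 𝒳₀.hom (Spec.map (CommRingCat.ofHom σ)) ⟶
      pullback S₀.hom (Spec.map (CommRingCat.ofHom σ)) := ((baseChangeHom σ).map f₀).left
  have hbc₁ : bcl ≫ pullback.fst S₀.hom (Spec.map (CommRingCat.ofHom σ)) =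
      pullback.fst 𝒳₀.hom (Spec.map (CommRingCat.ofHom σ)) ≫ G :=
    baseChangeHom_map_left_comp_fst σ f₀
  have hbc₂ : bcl ≫ pullback.snd S₀.hom (Spec.map (CommRingCat.ofHom σ)) =
      pullback.snd 𝒳₀.hom (Spec.map (CommRingCat.ofHom σ)) :=
    Over.w ((baseChangeHom σ).map f₀)
  have H : h𝒳.isoPullback.hom ≫ bcl = f.left ≫ hS.isoPullback.hom := by
    apply pullback.hom_ext
    · rw [Category.assoc, Category.assoc, hS.isoPullback_hom_fst, hbc₁, ← Category.assoc,
        h𝒳.isoPullback_hom_fst]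
      change π ≫ G = f.left ≫ eS₁.hom ≫ ℓ
      rw [← Category.assoc f.left]
      exact hsq𝒳.w
    · rw [Category.assoc, Category.assoc, hS.isoPullback_hom_snd, hbc₂, h𝒳.isoPullback_hom_snd,
        Over.w f]
  ext : 1
  change bcl ≫ hS.isoPullback.inv = h𝒳.isoPullback.inv ≫ f.left
  rw [← cancel_epi h𝒳.isoPullback.hom, ← Category.assoc, H, Category.assoc, Iso.hom_inv_id,
    Category.comp_id, Iso.hom_inv_id_assoc]

end Literature.AlgebraicGeometry.Limits

end
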